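import Literature.Claims.NS.PaiLimsuwan2026
import Literature.Analysis.FluidPDE.LeiZhang2017E8
import Literature.Analysis.FluidPDE.BoundedLerayHopfClay
import Literature.Analysis.FluidPDE.ClassicalNSFiniteEnergyEquality
import Literature.Analysis.FluidPDE.TaoLocalisationHolds
import Literature.Analysis.FluidPDE.NSCriticalClosureBesovKatoClass
import Literature.Analysis.FluidPDE.KatoCaloricField
import Literature.Analysis.FluidPDE.NSVorticityDifference
import HarnessLib

/-!
# Solo salvage for claim C136 `PaiLimsuwan2026` (cell `ns-claims`, D-0090): the on-path TRUE premises
# Step 1 (energy inequality (2.4)) and Step 8 (continuity of `t ↦ ‖∇u(t)‖²_{L²}`) in the kernel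

Claim C136: Zenodo 10.5281/zenodo.22107318 (2026), «Structural Calculus Framework: Global Existence and
Smoothness of 3D Navier–Stokes Equations», skeleton `Literature.Claims.NS.PaiLimsuwan2026` (typist-6 g4,
p503820 + rev 2 p504540; `step3_Stretch32_holds`, `step4_GN_holds` already discharged there). The chair's
KEYING (2026-08-27T06:06:01Z) puts the print-grain face `Step7A_L1toL2_abs` of (3.4) p.3 l.8–10 ON the
composition path via `step7_of_abs : Step1_Energy24 → Step8_GradsqCont → Step7A_L1toL2_abs → Step7_ExpFinite24`.
This file discharges the two TRUE premises of that bridge, so that on the path only the locator is left: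

* `step1_Energy24_holds : Step1_Energy24` — the energy inequality (2.4) p.2 for every finite-energy
  classical solution on `[0,T) × ℝ³` from a Clay datum, in the printed form
  `‖u(t)‖² + 2ν∫₀ᵗ‖∇u‖²_{op} ≤ ‖u(0)‖²`: Leray's energy EQUALITY for finite-energy classical solutions
  (`IsClassicalNSSolutionOn.energyEq_finiteEnergy`, Tao 2013 Lemma 8.1 / Leray 1934 (3.4), PROVED in the
  tree) plus `‖∇u‖_{op} ≤ |∇u|_F` (the skeleton's `gradsq` uses the operator norm; junk values of the
  Bochner/interval integrals are `0`, on the safe side of the inequality).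
* `step8_GradsqCont_holds : Step8_GradsqCont` — `t ↦ ∫‖∇u(t)‖²_{op}` is continuous on `[0,T)`: below
  every `S < T` the solution coincides with a Tao-class solution (`exists_isTaoSolutionOn_eqOn_of_slabSol`:
  finite energy ⇒ Leray–Hopf (`isLerayHopfOn_of_finiteEnergy`) ⇒ Kato (`isKatoSolutionOn_of_classical`) ⇒
  Tao-class below the lifespan (`exists_isTaoSolutionOn_of_isKatoSolutionOn`) ⇒ equal by H^∞ uniqueness
  (`IsClassicalNSSolutionOn.eq_of_hasBoundedSobolevNormsOn` with `tao2011_hasBoundedSobolevNormsOn_holds`)),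
  and **the gradient of a Tao-class solution is continuous into `L²`**
  (`continuousInLpOn_fderiv_of_isTaoSolutionOn`: the enstrophy balance `IsSmoothSpaceTimeOn.enstrophy_balance`
  of the DIFFERENCE field `u(·) − u(t₀)` gives `∫|∇(u(t) − u(t₀))|²_F → 0`, which dominates the operator
  norm), whence `ContinuousInLpOn.continuousOn_integral_norm_sq`.

Salvage seat `ns-claims-salvage-p4` g3 (solo lane, even row; no statement item). Nothing disputed is asserted:
both statements are the skeleton's typed Props proved outright; the locator `Step7A_L1toL2_abs` is the
refuter's (`…Theorems.PaiLimsuwan2026.not_Step7A_L1toL2_abs`).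

WHAT THIS IS NOT: not a claim about NS regularity or blow-up; not a claim about any author beyond the typed
locator.

## References
* J. Leray, Acta Math. 63 (1934), §17 (3.4). [`Leray1934`]
* T. Tao, Anal. PDE 6 (2013) = arXiv:1108.1165, Lemma 8.1, Cor. 11.1. [`Tao2011`]
-/

set_option linter.dupNamespace false

noncomputable section

open MeasureTheory Set Filter Topology Function
open scoped ENNReal NNReal ContDiff InnerProductSpace

namespace Summit.NavierStokesRegularity.NavierStokesRegularity.Theorems.PaiLimsuwan2026

open Literature.Analysis.FluidPDE Literature.Claims.NS.PaiLimsuwan2026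

/-! ## Step 1 — the energy inequality (2.4) -/

/-- Slice bound: `ofReal (∫‖∇v‖²_{op}) ≤ ∫⁻ |∇v|²_F` (junk value `0` on the left if not integrable).
[folklore] -/
theorem ofReal_integral_norm_fderiv_sq_le (v : E3 → E3) :
    ENNReal.ofReal (∫ x, ‖fderiv ℝ v x‖ ^ 2) ≤
      ∫⁻ x, ENNReal.ofReal (frobeniusNormSq (fderiv ℝ v x)) := by
  by_cases hi : Integrable (fun x => ‖fderiv ℝ v x‖ ^ 2) volume
  · rw [ofReal_integral_eq_lintegral_ofReal hi (ae_of_all _ fun x => by positivity)]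
    exact lintegral_mono fun x => ENNReal.ofReal_le_ofReal (sq_opNorm_le_frobeniusNormSq _)
  · rw [integral_undef hi, ENNReal.ofReal_zero]; exact bot_le

/-- **Step 1 of C136 — the energy inequality (2.4) p.2 — holds**: for every finite-energy classical
solution of the unforced system on `[0,T) × ℝ³` from a Clay datum and every `t ∈ [0,T)`,
`‖u(t)‖²_{L²} + 2ν ∫₀ᵗ ‖∇u(s)‖²_{L²} ds ≤ ‖u(0)‖²_{L²}` (operator norm of `∇u`; Leray's energy equality
for finite-energy classical solutions, `IsClassicalNSSolutionOn.energyEq_finiteEnergy`, and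
`‖∇u‖_{op} ≤ |∇u|_F`). [cite: Leray1934, §17 (3.4) p. 220] [cite: Tao2011, Lemma 8.1] -/
theorem step1_Energy24_holds : Step1_Energy24 := by
  intro ν T u₀ u p hS t ht
  have hν : 0 < ν := hS.visc
  rcases ht.1.eq_or_lt with h0 | htpos
  · subst h0
    simp [intervalIntegral.integral_same]
  have hsub : Icc (0 : ℝ) t ⊆ Ico 0 T := fun s hs => ⟨hs.1, hs.2.trans_lt ht.2⟩
  have hcl : IsClassicalNSSolutionOn (Icc 0 t) ν 0 u p := hS.solves.mono hsub (uniqueDiffOn_Icc htpos)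
  have hfe : ∃ A : ℝ≥0∞, A < ⊤ ∧ ∀ s ∈ Icc (0 : ℝ) t, ∫⁻ x, ‖u s x‖ₑ ^ 2 ≤ A := by
    obtain ⟨A, hA, hAle⟩ := hS.finiteEnergy
    exact ⟨A, hA, fun s hs => hAle s (hsub hs)⟩
  have hE := hcl.energyEq_finiteEnergy hν htpos hfe le_rfl ht.1 le_rfl
  obtain ⟨A, -, -, -, hgrad⟩ := energyClass_of_finiteEnergy hcl hν htpos hfe
  set D : ℝ≥0∞ := ∫⁻ τ in Ioo 0 t, ∫⁻ x, ENNReal.ofReal (frobeniusNormSq (fderiv ℝ (u τ) x)) with hD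
  -- the printed dissipation (operator norm, junk-safe) is dominated by the lower-integral one
  have hkey : ∫ τ in (0 : ℝ)..t, gradsq u τ ≤ D.toReal := by
    by_cases hint : IntervalIntegrable (gradsq u) volume 0 t
    · rw [intervalIntegral.integral_of_le ht.1]
      have hnn : 0 ≤ᵐ[volume.restrict (Ioc 0 t)] fun τ => gradsq u τ :=
        ae_of_all _ fun τ => integral_nonneg fun x => by positivity
      rw [integral_eq_lintegral_of_nonneg_ae hnn hint.1.aestronglyMeasurable]
      refine ENNReal.toReal_mono hgrad.ne ?_
      have hIoc : (volume.restrict (Ioc (0 : ℝ) t)) = volume.restrict (Ioo 0 t) :=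
        (Measure.restrict_congr_set Ioo_ae_eq_Ioc).symm
      rw [hIoc, hD]
      exact lintegral_mono fun τ => ofReal_integral_norm_fderiv_sq_le (u τ)
    · rw [intervalIntegral.integral_undef hint]; exact ENNReal.toReal_nonneg
  have he : ∀ s, energy u s = 2 * VectorCalculus.kineticEnergy (u s) := fun s => by
    simp only [energy, VectorCalculus.kineticEnergy]; ring
  rw [he, he]
  have h2 : 2 * ν * ∫ τ in (0 : ℝ)..t, gradsq u τ ≤ 2 * ν * D.toReal :=
    mul_le_mul_of_nonneg_left hkey (by positivity)
  linarith

/-! ## Finite-energy classical solutions on `[0,T)` are Tao-class below `T` -/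

/-- **A `SlabSol` coincides with a Tao-class solution on every `[0,S]`, `S < T`.** Finite energy ⇒
Leray–Hopf on `[0,S']` (`isLerayHopfOn_of_finiteEnergy`, `S < S' < T`) ⇒ Kato on `[0,S')`
(`isKatoSolutionOn_of_classical`) ⇒ a Tao-class solution from `u₀` on `[0,S]`
(`exists_isTaoSolutionOn_of_isKatoSolutionOn`), which equals `u` there by uniqueness in
`L^∞_t H^k` (`IsClassicalNSSolutionOn.eq_of_hasBoundedSobolevNormsOn`, the bounds of `u` by
`tao2011_hasBoundedSobolevNormsOn_holds`). [cite: Tao2011, Cor. 11.1 with Lemma 8.1] -/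
theorem exists_isTaoSolutionOn_eqOn_of_slabSol {ν T : ℝ} {u₀ : E3 → E3} {u : ℝ → E3 → E3}
    {p : ℝ → E3 → ℝ} (hS : SlabSol ν T u₀ u p) {S : ℝ} (hS0 : 0 < S) (hST : S < T) :
    ∃ (U : ℝ → E3 → E3) (P : ℝ → E3 → ℝ), IsTaoSolutionOn S ν u₀ U P ∧ ∀ t ∈ Icc 0 S, u t = U t := by
  have hν : 0 < ν := hS.visc
  set S' : ℝ := (S + T) / 2 with hS'
  have h1 : S < S' := by rw [hS']; linarith
  have h2 : S' < T := by rw [hS']; linarith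
  have hS'0 : 0 < S' := hS0.trans h1
  have hsub' : Icc (0 : ℝ) S' ⊆ Ico 0 T := fun s hs => ⟨hs.1, hs.2.trans_lt h2⟩
  have hcl' : IsClassicalNSSolutionOn (Icc 0 S') ν 0 u p := hS.solves.mono hsub' (uniqueDiffOn_Icc hS'0)
  obtain ⟨A, hA, hAle⟩ := hS.finiteEnergy
  have hfe' : ∃ A : ℝ≥0∞, A < ⊤ ∧ ∀ s ∈ Icc (0 : ℝ) S', ∫⁻ x, ‖u s x‖ₑ ^ 2 ≤ A :=
    ⟨A, hA, fun s hs => hAle s (hsub' hs)⟩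
  have hLH := (isLerayHopfOn_of_finiteEnergy hcl' hν hS'0 hfe').1
  have hclo : IsClassicalNSSolutionOn (Ico 0 S') ν 0 u p :=
    hcl'.mono Ico_subset_Icc_self (uniqueDiffOn_Ico 0 S')
  have hdec0 : HasRapidSpatialDecay (u 0) := by rw [hS.initial]; exact hS.data_decay
  have hK : IsKatoSolutionOn S' ν (u 0) u := isKatoSolutionOn_of_classical hν hS'0 hclo hLH hdec0
  rw [hS.initial] at hK
  obtain ⟨U, P, hUP⟩ :=
    exists_isTaoSolutionOn_of_isKatoSolutionOn hν hS.data_smooth hS.data_divFree hS.data_decay hK hS0 h1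
  refine ⟨U, P, hUP, fun t ht => ?_⟩
  have hsub : Icc (0 : ℝ) S ⊆ Ico 0 T := fun s hs => ⟨hs.1, hs.2.trans_lt hST⟩
  have hcl : IsClassicalNSSolutionOn (Icc 0 S) ν 0 u p := hS.solves.mono hsub (uniqueDiffOn_Icc hS0)
  have hE : ∃ C : ℝ≥0, ∀ s ∈ Icc (0 : ℝ) S, ∫⁻ x, ‖u s x‖ₑ ^ 2 ≤ C :=
    ⟨A.toNNReal, fun s hs => (hAle s (hsub hs)).trans (ENNReal.coe_toNNReal hA.ne).symm.le⟩
  have hBu : HasBoundedSobolevNormsOn (Icc 0 S) u := tao2011_hasBoundedSobolevNormsOn_holds hν hS0 hcl hE hdec0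
  exact hcl.eq_of_hasBoundedSobolevNormsOn hUP.classical hν.le hS0 hBu hUP.sobolev
    (by rw [hS.initial, hUP.initial]) ht

/-! ## The gradient of a Tao-class solution is continuous into `L²` -/

/-- `‖a − b‖ₑ² ≤ 2(‖a‖ₑ² + ‖b‖ₑ²)` in any seminormed group. [folklore] -/
theorem enorm_sub_sq_le {G : Type*} [SeminormedAddCommGroup G] (a b : G) :
    ‖a - b‖ₑ ^ 2 ≤ 2 * (‖a‖ₑ ^ 2 + ‖b‖ₑ ^ 2) := by
  have h : (‖a - b‖₊ : ℝ≥0) ^ 2 ≤ 2 * (‖a‖₊ ^ 2 + ‖b‖₊ ^ 2) := by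
    have h1 : ‖a - b‖ ≤ ‖a‖ + ‖b‖ := norm_sub_le a b
    have h2 : ‖a - b‖ * ‖a - b‖ ≤ (‖a‖ + ‖b‖) * (‖a‖ + ‖b‖) :=
      mul_le_mul h1 h1 (norm_nonneg _) (add_nonneg (norm_nonneg _) (norm_nonneg _))
    rw [← NNReal.coe_le_coe]
    push_cast
    nlinarith [h2, sq_nonneg (‖a‖ - ‖b‖)]
  have e : ∀ c : G, ‖c‖ₑ ^ 2 = ((‖c‖₊ ^ 2 : ℝ≥0) : ℝ≥0∞) := fun c => by
    rw [enorm_eq_nnnorm, ENNReal.coe_pow]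
  rw [e, e, e]
  calc ((‖a - b‖₊ ^ 2 : ℝ≥0) : ℝ≥0∞) ≤ ((2 * (‖a‖₊ ^ 2 + ‖b‖₊ ^ 2) : ℝ≥0) : ℝ≥0∞) :=
        ENNReal.coe_le_coe.2 h
    _ = 2 * ((‖a‖₊ ^ 2 : ℝ≥0) + ((‖b‖₊ ^ 2 : ℝ≥0) : ℝ≥0∞)) := by push_cast; ring

section TaoGradient

variable {S ν : ℝ} {u₀ : E3 → E3} {U : ℝ → E3 → E3} {P : ℝ → E3 → ℝ}

/-- **The gradient of a Tao-class solution is continuous into `L²(ℝ³)`** on `[0,S]`: `∇U(t) ∈ L²` for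
every `t` (`integrable_norm_fderiv_sq`), and `‖∇U(t) − ∇U(t₀)‖_{L²} → 0` as `t → t₀` because the
Frobenius energy `∫|∇(U(t) − U(t₀))|²_F` of the difference field is continuous in `t`
(`IsSmoothSpaceTimeOn.enstrophy_balance`, from the `L^∞_t H¹` bounds of `U` and `∂ₜU`) and vanishes at
`t = t₀`, while the operator norm is dominated by the Frobenius norm. [cite: Tao2011, Thm. 5.4 (iv)] -/
theorem continuousInLpOn_fderiv_of_isTaoSolutionOn
    (h : IsTaoSolutionOn S ν u₀ U P) (hS : 0 < S) :
    ContinuousInLpOn (Icc 0 S) 2 (fun t x => fderiv ℝ (U t) x) := by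
  have hsm : IsSmoothSpaceTimeOn (Icc 0 S) U := h.classical.smooth_velocity
  obtain ⟨C₁, hC₁⟩ := h.sobolev 1
  obtain ⟨D₁, hD₁⟩ := h.sobolev_dt 1
  have hUc : ∀ t ∈ Icc 0 S, ContDiff ℝ ∞ (U t) := fun t ht => h.classical.contDiff_velocity ht
  refine ⟨fun t ht => ?_, fun t₀ ht₀ => ?_⟩
  · exact (memLp_two_iff_integrable_sq_norm
      (((hUc t ht).continuous_fderiv (by simp)).aestronglyMeasurable)).2 (h.integrable_norm_fderiv_sq ht)
  have hU0 : ContDiff ℝ ∞ (U t₀) := hUc t₀ ht₀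
  -- the difference field `w(τ) = U(τ) − U(t₀)`
  set w : ℝ → E3 → E3 := U - fun _ => U t₀ with hw_def
  have hwτ : ∀ τ, w τ = U τ - U t₀ := fun τ => rfl
  have hw : IsSmoothSpaceTimeOn (Icc 0 S) w := hsm.sub (isSmoothSpaceTimeOn_const_time hU0 _)
  have hwc : ∀ τ ∈ Icc 0 S, ContDiff ℝ ∞ (w τ) := fun τ hτ => by rw [hwτ]; exact (hUc τ hτ).sub hU0
  -- `H¹` bounds for `w` and `∂ₜw`
  have hmeas : ∀ f : E3 → E3, ContDiff ℝ ∞ f →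
      Measurable fun x => ‖iteratedFDeriv ℝ 1 f x‖ₑ ^ 2 := fun f hf =>
    ((hf.continuous_iteratedFDeriv (m := 1) (by exact_mod_cast le_top)).enorm).measurable.pow_const _
  have hC : ∀ τ ∈ Icc 0 S, ∫⁻ x, ‖iteratedFDeriv ℝ 1 (w τ) x‖ₑ ^ 2 ≤ (2 * (C₁ + C₁) : ℝ≥0) := by
    intro τ hτ
    have e : ∀ x, iteratedFDeriv ℝ 1 (w τ) x = iteratedFDeriv ℝ 1 (U τ) x - iteratedFDeriv ℝ 1 (U t₀) x := by
      intro x; rw [hwτ]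
      exact iteratedFDeriv_sub_apply ((hUc τ hτ).of_le (mod_cast le_top)).contDiffAt
        (hU0.of_le (mod_cast le_top)).contDiffAt
    calc ∫⁻ x, ‖iteratedFDeriv ℝ 1 (w τ) x‖ₑ ^ 2
        ≤ ∫⁻ x, 2 * (‖iteratedFDeriv ℝ 1 (U τ) x‖ₑ ^ 2 + ‖iteratedFDeriv ℝ 1 (U t₀) x‖ₑ ^ 2) :=
          lintegral_mono fun x => by rw [e x]; exact enorm_sub_sq_le _ _
      _ = 2 * ((∫⁻ x, ‖iteratedFDeriv ℝ 1 (U τ) x‖ₑ ^ 2) + ∫⁻ x, ‖iteratedFDeriv ℝ 1 (U t₀) x‖ₑ ^ 2) := by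
          rw [lintegral_const_mul' _ _ (by norm_num), lintegral_add_left (hmeas _ (hUc τ hτ))]
      _ ≤ (2 * (C₁ + C₁) : ℝ≥0) := by
          push_cast
          gcongr
          · exact hC₁ τ hτ
          · exact hC₁ t₀ ht₀
  have hD : ∀ τ ∈ Icc 0 S,
      ∫⁻ x, ‖iteratedFDeriv ℝ 1 (timeDerivWithin (Icc 0 S) w τ) x‖ₑ ^ 2 ≤ D₁ := by
    intro τ hτ
    have e : timeDerivWithin (Icc 0 S) w τ = timeDerivWithin (Icc 0 S) U τ := by
      funext x
      rw [hw_def, hsm.timeDerivWithin_sub (isSmoothSpaceTimeOn_const_time hU0 _) hτ x]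
      simp [timeDerivWithin_apply]
    rw [e]; exact hD₁ τ hτ
  obtain ⟨-, hFc, -⟩ := hw.enstrophy_balance hS hC hD
  -- `F(t₀) = 0`
  have hF0 : (∫ x, frobeniusNormSq (fderiv ℝ (w t₀) x)) = 0 := by
    have h0 : w t₀ = fun _ => 0 := by funext x; simp [hwτ]
    simp [h0, frobeniusNormSq_zero]
  -- pointwise: `∇w(τ) = ∇U(τ) − ∇U(t₀)`
  have hDw : ∀ τ ∈ Icc 0 S, ∀ x, fderiv ℝ (w τ) x = fderiv ℝ (U τ) x - fderiv ℝ (U t₀) x := by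
    intro τ hτ x
    rw [hwτ]
    exact fderiv_sub (((hUc τ hτ).differentiable (by simp)) x) ((hU0.differentiable (by simp)) x)
  -- the `L²` distance of the gradients is dominated by `√F`
  have hle : ∀ τ ∈ Icc 0 S,
      eLpNorm ((fun x => fderiv ℝ (U τ) x) - fun x => fderiv ℝ (U t₀) x) 2 volume ≤
        (ENNReal.ofReal (∫ x, frobeniusNormSq (fderiv ℝ (w τ) x))) ^ (1 / 2 : ℝ) := by
    intro τ hτ
    refine eLpNorm_two_le_rpow_of_lintegral_sq_le ?_
    have hi1 := h.integrable_norm_fderiv_sq hτ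
    have hi0 := h.integrable_norm_fderiv_sq ht₀
    have hint : Integrable (fun x => frobeniusNormSq (fderiv ℝ (w τ) x)) volume := by
      refine (((hi1.add hi0).const_mul 6).mono'
        (LerayHopfProofs.continuous_frobeniusNormSq.comp
          ((hwc τ hτ).continuous_fderiv (by simp))).aestronglyMeasurable
        (ae_of_all _ fun x => ?_))
      rw [Real.norm_eq_abs, abs_of_nonneg (frobeniusNormSq_nonneg _), hDw τ hτ x, Pi.add_apply]
      have h3 := frobeniusNormSq_le_three_mul (fderiv ℝ (U τ) x - fderiv ℝ (U t₀) x)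
      have hn := norm_sub_le (fderiv ℝ (U τ) x) (fderiv ℝ (U t₀) x)
      have hn0 : 0 ≤ ‖fderiv ℝ (U τ) x - fderiv ℝ (U t₀) x‖ := norm_nonneg _
      nlinarith [h3, hn, hn0, sq_nonneg (‖fderiv ℝ (U τ) x‖ - ‖fderiv ℝ (U t₀) x‖),
        norm_nonneg (fderiv ℝ (U τ) x), norm_nonneg (fderiv ℝ (U t₀) x)]
    rw [ofReal_integral_eq_lintegral_ofReal hint (ae_of_all _ fun x => frobeniusNormSq_nonneg _)]
    refine lintegral_mono fun x => ?_
    rw [Pi.sub_apply, ← hDw τ hτ x, ← ofReal_norm, ← ENNReal.ofReal_pow (norm_nonneg _)]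
    exact ENNReal.ofReal_le_ofReal (sq_opNorm_le_frobeniusNormSq _)
  -- `√F(τ) → 0` as `τ → t₀` within `[0,S]`
  have hT0 : Tendsto (fun τ => (ENNReal.ofReal (∫ x, frobeniusNormSq (fderiv ℝ (w τ) x))) ^ (1 / 2 : ℝ))
      (𝓝[Icc 0 S] t₀) (𝓝 0) := by
    have h1 : Tendsto (fun τ => ∫ x, frobeniusNormSq (fderiv ℝ (w τ) x)) (𝓝[Icc 0 S] t₀) (𝓝 0) := by
      have hc := hFc t₀ ht₀
      rw [ContinuousWithinAt, hF0] at hc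
      exact hc
    have h2 : Tendsto (fun τ => ENNReal.ofReal (∫ x, frobeniusNormSq (fderiv ℝ (w τ) x)))
        (𝓝[Icc 0 S] t₀) (𝓝 0) := by
      have := (ENNReal.continuous_ofReal.tendsto 0).comp h1
      rwa [ENNReal.ofReal_zero] at this
    have h3 := ((ENNReal.continuous_rpow_const (y := (1 / 2 : ℝ))).tendsto 0).comp h2
    rwa [ENNReal.zero_rpow_of_pos (by norm_num : (0 : ℝ) < 1 / 2)] at h3
  exact tendsto_of_tendsto_of_tendsto_of_le_of_le' tendsto_const_nhds hT0
    (Eventually.of_forall fun _ => bot_le) (eventually_nhdsWithin_of_forall fun τ hτ => hle τ hτ)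

/-- `t ↦ ∫‖∇U(t)‖²_{op}` is continuous on `[0,S]` along a Tao-class solution. [cite: Tao2011, Thm. 5.4 (iv)] -/
theorem continuousOn_gradsq_of_isTaoSolutionOn
    (h : IsTaoSolutionOn S ν u₀ U P) (hS : 0 < S) : ContinuousOn (gradsq U) (Icc 0 S) :=
  (continuousInLpOn_fderiv_of_isTaoSolutionOn h hS).continuousOn_integral_norm_sq

end TaoGradient

/-! ## Step 8 — continuity of `t ↦ ‖∇u(t)‖²_{L²}` on `[0,T)` -/

/-- **Step 8 of C136 holds**: along every finite-energy classical solution on `[0,T) × ℝ³` from a Clay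
datum, `t ↦ ‖∇u(t)‖²_{L²}` (operator norm) is continuous on `[0,T)` — below every `S < T` the solution
is Tao-class (`exists_isTaoSolutionOn_eqOn_of_slabSol`) and the gradient of a Tao-class solution is
continuous into `L²` (`continuousOn_gradsq_of_isTaoSolutionOn`). [cite: Tao2011, Cor. 11.1, Thm. 5.4 (iv)] -/
theorem step8_GradsqCont_holds : Step8_GradsqCont := by
  intro ν T u₀ u p hS t ht
  set S₁ : ℝ := (t + T) / 2 with hS₁
  have htS : t < S₁ := by rw [hS₁]; linarith [ht.2]
  have hS₁T : S₁ < T := by rw [hS₁]; linarith [ht.2]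
  have hS₁0 : 0 < S₁ := ht.1.trans_lt htS
  obtain ⟨U, P, hUP, hEq⟩ := exists_isTaoSolutionOn_eqOn_of_slabSol hS hS₁0 hS₁T
  have hcU : ContinuousOn (gradsq U) (Icc 0 S₁) := continuousOn_gradsq_of_isTaoSolutionOn hUP hS₁0
  have htI : t ∈ Icc 0 S₁ := ⟨ht.1, htS.le⟩
  have hcu : ContinuousWithinAt (gradsq u) (Icc 0 S₁) t :=
    (hcU t htI).congr (fun s hs => by simp only [gradsq, hEq s hs]) (by simp only [gradsq, hEq t htI])
  exact hcu.mono_of_mem_nhdsWithin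
    (mem_nhdsWithin.2 ⟨Iio S₁, isOpen_Iio, htS, fun s hs => ⟨hs.2.1, le_of_lt hs.1⟩⟩)

end Summit.NavierStokesRegularity.NavierStokesRegularity.Theorems.PaiLimsuwan2026

end
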